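import Mathlib
import Summits.ResolutionOfSingularities.ResolutionOfSingularities.Theorems.WildQuotientsKiralyLutkebohmertLemmas
import HarnessLib

/-!
# Király–Lütkebohmert (ANT 7 (2013)), Prop. 6 and Thm. 2 (e) ⇒ (a): generators of the
# augmentation ideal in the residue-trivial case; pseudoreflections have principal augmentation

Route `ResolutionOfSingularities/WildQuotients`; helper toward the depth-0 / kill-criterion dictionary
of the crux `CyclicQuotientFourfolds` (stmt-ResolutionOfSingularities-17941, research stub
`stub_reachLowerInFX`: a chart point is «killable» when the augmentation ideal is principal there).
F. Király, W. Lütkebohmert, *Group actions of prime order on local normal rings*, Algebra & Number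
Theory 7 (2013) 63–74, §1. The tree already holds Thm. 2 (a) ⇒ (c) ⇒ (d) (`kl_free`,
`kl_isRegularLocalRing_eqLocus`, file `WildQuotientsKiralyLutkebohmert.lean`). This file adds, for a
local Noetherian ring `B` with a ring automorphism `σ` such that the canonical map of residue fields
`k_A → k_B` (`A = B^σ`) is onto — rendered as `∀ b, ∃ a, σ a = a ∧ b − a ∈ 𝔪_B` —

* `kl_augIdeal_eq_span_image` — **Prop. 6 (i)**: the augmentation ideal
  `I_G = (σ c − c : c ∈ B)` is generated by the `σ s − s`, `s` in ANY generating set `S` of `𝔪_B`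
  (Nakayama: `I(𝔪_B) ⊆ 𝔪_B · I_G + Σ B · I(s)`);
* `kl_exists_augIdeal_eq_span_singleton` — **Prop. 6 (ii)**: if `I_G` is principal then
  `I_G = (σ s − s)` for one of the generators `s ∈ S`;
* `kl_augIdeal_eq_span_singleton_of_pseudoreflection` — **Thm. 2 (e) ⇒ (a)**: if `𝔪_B` is
  generated by one element `y` together with `σ`-invariant elements (a pseudoreflection, Def. 1),
  then `I_G = (σ y − y)` is principal.

Census remark (this hand): Thm. 2 of the paper proves `(a) ⇔ (b) ⇒ (c)`, `(c) ⇔ (d)` for `B`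
regular, and `(a) ⇔ (e)` when `k_A = k_B`; the implication «`A` regular ⇒ `I_G` principal»
(`(d) ⇒ (a)`) is NOT asserted in print. No order / primality hypothesis on `σ` is needed here, as in
the paper's proof of Prop. 6.

[OURS · crux stmt-ResolutionOfSingularities-17941 · helper (def-free), printed statements of
KiralyLutkebohmert2013 Prop. 6 / Thm. 2; counted 0; AI-level work, weaker than expert review.]
-/

-- single-problem summit: the doubled namespace component `ResolutionOfSingularities` is forced
set_option linter.dupNamespace false

open IsLocalRing

namespace Summit.ResolutionOfSingularities.ResolutionOfSingularities.Theorems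

variable {B : Type*} [CommRing B]

/-- **Király–Lütkebohmert, Remark 3 (i)** (twisted Leibniz rule of the augmentation map
`I = σ − id`): `I(b c) = I(b) σ(c) + b I(c)`. [cite: KiralyLutkebohmert2013, Rem. 3 (i)] -/
theorem kl_aug_mul (σ : B ≃+* B) (b c : B) :
    σ (b * c) - b * c = (σ b - b) * σ c + b * (σ c - c) := by
  rw [map_mul]; ring

/-- **Király–Lütkebohmert, Proposition 6 (i)**: let `B` be a local Noetherian ring with a ring
automorphism `σ` such that every element of `B` is congruent modulo `𝔪_B` to a `σ`-invariant
element (the residue field of the fixed ring maps ONTO that of `B`). If `S ⊆ B` generates the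
maximal ideal, then the augmentation ideal `(σ c − c : c ∈ B)` is generated by the `σ s − s`,
`s ∈ S`. Proof as printed: `I(B) = I(𝔪_B)`, `𝔪_B = 𝔪_B² + Σ A·s`, `I(𝔪_B²) ⊆ 𝔪_B · I(𝔪_B)`
(Remark 3), Nakayama. [cite: KiralyLutkebohmert2013, Prop. 6 (i), pp. 68–69] -/
theorem kl_augIdeal_eq_span_image [IsLocalRing B] [IsNoetherianRing B] (σ : B ≃+* B)
    (hres : ∀ b : B, ∃ a : B, σ a = a ∧ b - a ∈ maximalIdeal B)
    {S : Set B} (hS : Ideal.span S = maximalIdeal B) :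
    Ideal.span (Set.range fun c : B => σ c - c) = Ideal.span ((fun c : B => σ c - c) '' S) := by
  have hmem : ∀ c : B, σ c - c ∈ Ideal.span (Set.range fun c : B => σ c - c) :=
    fun c => Ideal.subset_span ⟨c, rfl⟩
  apply le_antisymm
  · -- Nakayama: `I_G ≤ J + 𝔪_B • I_G`
    refine Submodule.le_of_le_smul_of_le_jacobson_bot (IsNoetherian.noetherian _)
      (maximalIdeal_le_jacobson ⊥) ?_
    have hS_le : ∀ m ∈ maximalIdeal B, σ m - m ∈
        Ideal.span ((fun c : B => σ c - c) '' S) ⊔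
          maximalIdeal B • Ideal.span (Set.range fun c : B => σ c - c) := by
      intro m hm
      rw [← hS] at hm
      induction hm using Submodule.span_induction with
      | mem x hx => exact Ideal.mem_sup_left (Ideal.subset_span ⟨x, hx, rfl⟩)
      | zero => simp
      | add x y hx hy ihx ihy =>
        have e : σ (x + y) - (x + y) = (σ x - x) + (σ y - y) := by rw [map_add]; ring
        rw [e]
        exact add_mem ihx ihy
      | smul a x hx ihx =>
        show σ (a * x) - a * x ∈ _
        rw [kl_aug_mul]
        refine add_mem (Ideal.mem_sup_right ?_) (Ideal.mul_mem_left _ a ihx)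
        have hx' : σ x ∈ maximalIdeal B := kl_map_mem_maximalIdeal σ (hS ▸ hx)
        rw [mul_comm]
        exact Ideal.mul_mem_mul hx' (hmem a)
    rw [Ideal.span_le]
    rintro _ ⟨c, rfl⟩
    obtain ⟨a, ha, hca⟩ := hres c
    have e : σ c - c = σ (c - a) - (c - a) := by rw [map_sub, ha]; ring
    show σ c - c ∈ _
    rw [e]
    exact hS_le _ hca
  · apply Ideal.span_mono
    rintro _ ⟨c, _, rfl⟩
    exact ⟨c, rfl⟩

/-- **Király–Lütkebohmert, Proposition 6 (ii)**: in the situation of `kl_augIdeal_eq_span_image`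
(local Noetherian `B`, residue-surjective fixed ring, `S` a non-empty generating set of `𝔪_B`), if
the augmentation ideal is principal then it is generated by `σ s − s` for a suitable generator
`s ∈ S` (Nakayama: `I_G / 𝔪_B I_G` has dimension `≤ 1` and is spanned by the classes of the
`σ s − s`). [cite: KiralyLutkebohmert2013, Prop. 6 (ii), p. 69] -/
theorem kl_exists_augIdeal_eq_span_singleton [IsLocalRing B] [IsNoetherianRing B] (σ : B ≃+* B)
    (hres : ∀ b : B, ∃ a : B, σ a = a ∧ b - a ∈ maximalIdeal B)
    {S : Set B} (hS : Ideal.span S = maximalIdeal B) (hSne : S.Nonempty)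
    (hP : (Ideal.span (Set.range fun c : B => σ c - c)).IsPrincipal) :
    ∃ s ∈ S, Ideal.span (Set.range fun c : B => σ c - c) = Ideal.span {σ s - s} := by
  set I := Ideal.span (Set.range fun c : B => σ c - c) with hI_def
  have hIJ : I = Ideal.span ((fun c : B => σ c - c) '' S) := kl_augIdeal_eq_span_image σ hres hS
  have hmem : ∀ c : B, σ c - c ∈ I := fun c => Ideal.subset_span ⟨c, rfl⟩
  by_cases h0 : I = ⊥
  · obtain ⟨s, hs⟩ := hSne
    refine ⟨s, hs, ?_⟩
    have hs0 : σ s - s = 0 := by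
      have := hmem s
      rwa [h0, Ideal.mem_bot] at this
    rw [h0, hs0, eq_comm, Ideal.span_singleton_eq_bot]
  · set x := Submodule.IsPrincipal.generator I with hx_def
    have hIx : I = Ideal.span {x} := (Ideal.span_singleton_generator I).symm
    have key : ∃ s ∈ S, σ s - s ∉ maximalIdeal B • I := by
      by_contra hcon
      push Not at hcon
      apply h0
      refine Submodule.eq_bot_of_le_smul_of_le_jacobson_bot (maximalIdeal B) I
        (IsNoetherian.noetherian _) ?_ (maximalIdeal_le_jacobson ⊥)
      calc I = Ideal.span ((fun c : B => σ c - c) '' S) := hIJ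
        _ ≤ maximalIdeal B • I := by
          rw [Ideal.span_le]
          rintro _ ⟨s, hs, rfl⟩
          exact hcon s hs
    obtain ⟨s, hs, hsm⟩ := key
    refine ⟨s, hs, ?_⟩
    have hsx : σ s - s ∈ Ideal.span {x} := hIx ▸ hmem s
    obtain ⟨d, hd⟩ := Ideal.mem_span_singleton'.mp hsx
    have hdu : IsUnit d := by
      by_contra hdu
      apply hsm
      have hdm : d ∈ maximalIdeal B :=
        (IsLocalRing.mem_maximalIdeal _).mpr (mem_nonunits_iff.mpr hdu)
      rw [← hd]
      exact Submodule.smul_mem_smul hdm (hIx ▸ Ideal.mem_span_singleton_self x)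
    rw [← hd, Ideal.span_singleton_mul_left_unit hdu, ← hIx]

/-- **Király–Lütkebohmert, Theorem 2, (e) ⇒ (a)** (residue-trivial case): let `B` be a local
Noetherian ring with a ring automorphism `σ` whose fixed ring maps onto the residue field of `B`.
If `σ` acts as a PSEUDOREFLECTION — the maximal ideal is generated by one element `y` together
with a set `S` of `σ`-invariant elements (Def. 1: a system of parameters `(y, y₂, …, y_d)` with
`y₂, …, y_d` invariant) — then the augmentation ideal is principal, generated by `σ y − y`.
[cite: KiralyLutkebohmert2013, Thm. 2 (e)⇒(a) and Def. 1, pp. 64–65, 69] -/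
theorem kl_augIdeal_eq_span_singleton_of_pseudoreflection [IsLocalRing B] [IsNoetherianRing B]
    (σ : B ≃+* B) (hres : ∀ b : B, ∃ a : B, σ a = a ∧ b - a ∈ maximalIdeal B)
    (y : B) {S : Set B} (hSfix : ∀ s ∈ S, σ s = s)
    (hgen : Ideal.span (insert y S) = maximalIdeal B) :
    Ideal.span (Set.range fun c : B => σ c - c) = Ideal.span {σ y - y} := by
  rw [kl_augIdeal_eq_span_image σ hres hgen, Set.image_insert_eq, Ideal.span_insert]
  have h0 : Ideal.span ((fun c : B => σ c - c) '' S) = ⊥ := by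
    rw [Ideal.span_eq_bot]
    rintro _ ⟨s, hs, rfl⟩
    exact sub_eq_zero.mpr (hSfix s hs)
  rw [h0, sup_bot_eq]

/-- **Corollary (the pseudoreflection criterion is an «iff» for principal NON-ZERO augmentation,
pointwise form used by the kill criterion)**: under the hypotheses of Prop. 6 with a finite
generating family `x : Fin (n+1) → B` of `𝔪_B`, a principal augmentation ideal is generated by
`σ (x i) − x i` for some index `i`. [cite: KiralyLutkebohmert2013, Prop. 6 (ii)] -/
theorem kl_exists_index_augIdeal_eq_span_singleton [IsLocalRing B] [IsNoetherianRing B]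
    (σ : B ≃+* B) (hres : ∀ b : B, ∃ a : B, σ a = a ∧ b - a ∈ maximalIdeal B)
    {n : ℕ} (x : Fin (n + 1) → B) (hx : Ideal.span (Set.range x) = maximalIdeal B)
    (hP : (Ideal.span (Set.range fun c : B => σ c - c)).IsPrincipal) :
    ∃ i : Fin (n + 1), Ideal.span (Set.range fun c : B => σ c - c) = Ideal.span {σ (x i) - x i} := by
  obtain ⟨s, ⟨i, rfl⟩, h⟩ :=
    kl_exists_augIdeal_eq_span_singleton σ hres hx (Set.range_nonempty x) hP
  exact ⟨i, h⟩

end Summit.ResolutionOfSingularities.ResolutionOfSingularities.Theorems
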